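import Summits.BirchSwinnertonDyer.BirchSwinnertonDyer.Theses.BiquadraticEisensteinDescent
import Literature.NumberTheory.NumberFields.ClassNumberCrudeBound
import HarnessLib

set_option linter.dupNamespace false -- `Summit.BirchSwinnertonDyer.BirchSwinnertonDyer.Theorems.…` (summit = sub)
set_option autoImplicit false

/-!
# Crux `HeegnerTwistCouplingInSupply` (stmt-BirchSwinnertonDyer-21381), line `size-tail`: the coupling-free regime in its
# OPTIMAL form `h(K′) < p` — the h-TAIL stub, its composition, and its comparison with the registered `121·|d_K′| < p` tail

Route `BiquadraticEisensteinDescent` (cell `pub/bsd-wall`, row 12; width seat `bsd-wall-cm-bed-w4` g5 in support of the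
row-12 KEY lead `bsd-line-ibd-p1`, skeleton of record `size_tail` d16d457aa832b278 by `bsd-wall-cm-bed-p1` g0).

The registered frame splits the crux on «some Heegner field `K′` of `N_W` with `4 < |d_K′|` and `121·|d_K′| < p` carries a
non-vanishing twist `L(W^{(d_K′)},1) ≠ 0`» — then `p ∤ h(K′)` is free because `h(K′) ≤ 121·|d_K′| < p` (stub
`stub_sizeIndivisible`, PROVED, p595406). Crux-ideation seat 2 g7 (`OBSTRUCTIONS-seat2-g7.md` §8) records that this bulk
is EMPTY for every `p ≤ 605` (the least imaginary quadratic `|d| > 4` is `7`, and `121·7 = 847`), so on every census pair the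
registered tail stub IS the crux; §10(i) names the only rigid coupling-free regime known: `h(K′) < p`.

This file types that optimal regime (THEOREMS ONLY, no definition, no named fact, nothing about BSD asserted):

* `not_dvd_classNumber_of_lt` — `h(K′) < p ⇒ p ∤ h(K′)` (`h ≥ 1`);
* `classNumber_lt_of_small_discr` — `K′` imaginary quadratic, `121·|d_K′| < p ⇒ h(K′) < p` (the registered threshold is a
  sub-case of the h-threshold; tree Minkowski bound `classNumber_le_pow_mul_natAbs_discr`);
* `heegnerTwistCouplingInSupply_of_hTail` — COMPOSITION: the h-tail statement («… and every Heegner `K′` of `N_W` with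
  `4 < |d_K′|`, `h(K′) < p` has `L(W^{(d_K′)},1) = 0 ⟹ ∃ good `K′`») implies the crux BY NAME (case split on a Heegner
  `K′` with `h(K′) < p` and a non-vanishing twist);
* `hTail_of_sizeTail` — the REGISTERED stub `stub_tailCoupling` (threshold `121·|d| < p`, verbatim signature) implies the
  h-tail statement: re-registering the line with the h-threshold is a WEAKENING of the open stub, certified here;
* `hTail_iff` — honesty lemma: the h-tail statement is EQUIVALENT to the crux (the frame is truth-preserving and does not
  reduce the crux; it only records that the whole content sits on pairs `(W, p)` all of whose Heegner fields with
  `h(K′) < p` — a finite list per `p`: `h ≤ 4` ⟺ 95 fields for `p = 5` — have vanishing twist or are absent).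

Supports stmt-BirchSwinnertonDyer-21381; closes nothing. BSD is not proved by any of this; the coupling (the tail) is open.
-/

noncomputable section

open scoped NumberField

open WeierstrassCurve NumberField
  Literature.NumberTheory.EllipticCurves Literature.NumberTheory.EllipticCurves.Rank1Residual

namespace Summit.BirchSwinnertonDyer.BirchSwinnertonDyer.Theorems.BiquadraticEisensteinDescentHeegnerTwistCouplingInSupplyHTail

open Summit.BirchSwinnertonDyer.BirchSwinnertonDyer.Theses.BiquadraticEisensteinDescent

/-- `h(K) < p ⇒ p ∤ h(K)`: the class number is positive, so a divisor of it is at most `h(K)`. The coupling-free regime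
of the crux in its optimal form (crux-ideation seat 2 g7 §10(i)). [folklore] -/
theorem not_dvd_classNumber_of_lt {p : ℕ} {K : Type*} [Field K] [NumberField K]
    (h : NumberField.classNumber K < p) : ¬ p ∣ NumberField.classNumber K := by
  intro hdvd
  have hpos : 0 < NumberField.classNumber K := Fintype.card_pos
  exact absurd (Nat.le_of_dvd hpos hdvd) (not_le.mpr h)

/-- The registered SIZE threshold is a sub-case of the h-threshold: an imaginary quadratic field `K` with
`121·|d_K| < p` has `h(K) < p`, since `h(K) ≤ 11^{n_K}·|d_K| = 121·|d_K|` (tree Minkowski bound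
`Literature.NumberTheory.NumberFields.classNumber_le_pow_mul_natAbs_discr`, `n_K = 2`).
[cite: ThornerZaman2019, Lemma 2.4 (proof)] -/
theorem classNumber_lt_of_small_discr {p : ℕ} {K : Type} [Field K] [NumberField K]
    (hK : IsImaginaryQuadratic K) (hlt : 121 * (NumberField.discr K).natAbs < p) :
    NumberField.classNumber K < p := by
  have hle := Literature.NumberTheory.NumberFields.classNumber_le_pow_mul_natAbs_discr K
  rw [hK.1] at hle
  omega

/-- **COMPOSITION for the h-threshold frame.** If, for `(W, p)` in the CM inert-bad rank-one corner with the ∀B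
class-number supply, the conclusion of the crux holds WHENEVER every Heegner field `K′` of `N_W` with `4 < |d_K′|` and
`h(K′) < p` has vanishing twist `L(W^{(d_K′)},1) = 0` (the h-TAIL statement), then the crux
`HeegnerTwistCouplingInSupply` holds (BY NAME): either some Heegner `K′` with `4 < |d_K′|`, `h(K′) < p` has a non-vanishing
twist — then `p ∤ h(K′)` by `not_dvd_classNumber_of_lt` and `K′` is the witness — or the h-tail hypothesis is in force.
[folklore] -/
theorem heegnerTwistCouplingInSupply_of_hTail
    (hTail : ∀ (W : WeierstrassCurve ℚ) [W.IsElliptic] [W.IsGloballyMinimal] (p : ℕ) [Fact p.Prime]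
      [NeZero (W.conductorNorm ℤ)],
      W.HasCM → W.analyticRank = 1 → 5 ≤ p → CMInert W p → ¬ Good W p →
      (∀ B : ℕ, ∃ (K : Type) (_ : Field K) (_ : NumberField K), IsImaginaryQuadratic K ∧
        B < (NumberField.discr K).natAbs ∧ 4 < (NumberField.discr K).natAbs ∧
        SatisfiesHeegnerHypothesis (W.conductorNorm ℤ) K ∧ ¬ p ∣ NumberField.classNumber K) →
      (∀ (K : Type) [Field K] [NumberField K], IsImaginaryQuadratic K → 4 < (NumberField.discr K).natAbs →
        SatisfiesHeegnerHypothesis (W.conductorNorm ℤ) K → NumberField.classNumber K < p →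
        (W.quadraticTwist (NumberField.discr K : ℚ)).entireLFunction 1 = 0) →
      ∃ (K : Type) (_ : Field K) (_ : NumberField K), IsImaginaryQuadratic K ∧
        4 < (NumberField.discr K).natAbs ∧ SatisfiesHeegnerHypothesis (W.conductorNorm ℤ) K ∧
        (W.quadraticTwist (NumberField.discr K : ℚ)).entireLFunction 1 ≠ 0 ∧
        ¬ p ∣ NumberField.classNumber K) :
    HeegnerTwistCouplingInSupply := by
  intro W _ _ p _ _ hCM hr hp5 hin hbad hsup
  by_cases h : ∃ (K : Type) (_ : Field K) (_ : NumberField K), IsImaginaryQuadratic K ∧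
      4 < (NumberField.discr K).natAbs ∧ SatisfiesHeegnerHypothesis (W.conductorNorm ℤ) K ∧
      NumberField.classNumber K < p ∧ (W.quadraticTwist (NumberField.discr K : ℚ)).entireLFunction 1 ≠ 0
  · obtain ⟨K, _, _, hK, hd4, hHN, hsmall, hL⟩ := h
    exact ⟨K, inferInstance, inferInstance, hK, hd4, hHN, hL, not_dvd_classNumber_of_lt hsmall⟩
  · refine hTail W p hCM hr hp5 hin hbad hsup ?_
    intro K _ _ hK hd4 hHN hsmall
    by_contra hL
    exact h ⟨K, inferInstance, inferInstance, hK, hd4, hHN, hsmall, hL⟩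

/-- **The registered tail stub implies the h-tail stub.** `stub_tailCoupling` of skeleton `size_tail`
(d16d457aa832b278; hypothesis «every Heegner `K′` with `4 < |d|`, `121·|d| < p` has vanishing twist», VERBATIM signature as
the antecedent) implies the h-tail statement (hypothesis «every Heegner `K′` with `4 < |d|`, `h(K′) < p` has vanishing
twist»): the h-hypothesis is stronger (`121·|d| < p ⇒ h < p`, `classNumber_lt_of_small_discr`), so the h-tail is the
weaker statement. Certifies that re-registering the line with the h-threshold loses nothing already proved or delegated.
[folklore] -/
theorem hTail_of_sizeTail
    (hSize : ∀ (W : WeierstrassCurve ℚ) [W.IsElliptic] [W.IsGloballyMinimal] (p : ℕ) [Fact p.Prime]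
      [NeZero (W.conductorNorm ℤ)],
      W.HasCM → W.analyticRank = 1 → 5 ≤ p → CMInert W p → ¬ Good W p →
      (∀ B : ℕ, ∃ (K : Type) (_ : Field K) (_ : NumberField K), IsImaginaryQuadratic K ∧
        B < (NumberField.discr K).natAbs ∧ 4 < (NumberField.discr K).natAbs ∧
        SatisfiesHeegnerHypothesis (W.conductorNorm ℤ) K ∧ ¬ p ∣ NumberField.classNumber K) →
      (∀ (K : Type) [Field K] [NumberField K], IsImaginaryQuadratic K → 4 < (NumberField.discr K).natAbs →
        SatisfiesHeegnerHypothesis (W.conductorNorm ℤ) K → 121 * (NumberField.discr K).natAbs < p →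
        (W.quadraticTwist (NumberField.discr K : ℚ)).entireLFunction 1 = 0) →
      ∃ (K : Type) (_ : Field K) (_ : NumberField K), IsImaginaryQuadratic K ∧
        4 < (NumberField.discr K).natAbs ∧ SatisfiesHeegnerHypothesis (W.conductorNorm ℤ) K ∧
        (W.quadraticTwist (NumberField.discr K : ℚ)).entireLFunction 1 ≠ 0 ∧
        ¬ p ∣ NumberField.classNumber K) :
    ∀ (W : WeierstrassCurve ℚ) [W.IsElliptic] [W.IsGloballyMinimal] (p : ℕ) [Fact p.Prime]
      [NeZero (W.conductorNorm ℤ)],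
      W.HasCM → W.analyticRank = 1 → 5 ≤ p → CMInert W p → ¬ Good W p →
      (∀ B : ℕ, ∃ (K : Type) (_ : Field K) (_ : NumberField K), IsImaginaryQuadratic K ∧
        B < (NumberField.discr K).natAbs ∧ 4 < (NumberField.discr K).natAbs ∧
        SatisfiesHeegnerHypothesis (W.conductorNorm ℤ) K ∧ ¬ p ∣ NumberField.classNumber K) →
      (∀ (K : Type) [Field K] [NumberField K], IsImaginaryQuadratic K → 4 < (NumberField.discr K).natAbs →
        SatisfiesHeegnerHypothesis (W.conductorNorm ℤ) K → NumberField.classNumber K < p →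
        (W.quadraticTwist (NumberField.discr K : ℚ)).entireLFunction 1 = 0) →
      ∃ (K : Type) (_ : Field K) (_ : NumberField K), IsImaginaryQuadratic K ∧
        4 < (NumberField.discr K).natAbs ∧ SatisfiesHeegnerHypothesis (W.conductorNorm ℤ) K ∧
        (W.quadraticTwist (NumberField.discr K : ℚ)).entireLFunction 1 ≠ 0 ∧
        ¬ p ∣ NumberField.classNumber K := by
  intro W _ _ p _ _ hCM hr hp5 hin hbad hsup hvan
  exact hSize W p hCM hr hp5 hin hbad hsup fun K _ _ hK hd4 hHN hsmall ↦
    hvan K hK hd4 hHN (classNumber_lt_of_small_discr hK hsmall)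

/-- **Honesty lemma: the h-tail statement is EQUIVALENT to the crux.** `⇒` is the composition
`heegnerTwistCouplingInSupply_of_hTail`; `⇐` drops the tail hypothesis. So the BULK/TAIL frame (with either threshold) is
truth-preserving and does NOT reduce the crux: its whole content is carried by the pairs `(W, p)` none of whose Heegner
fields `K′` with `h(K′) < p` (a finite list for each `p`) has a non-vanishing twist — the generic case as `N_W` grows at
fixed `p` (crux-ideation seat 2 g7 §8). [folklore] -/
theorem hTail_iff :
    (∀ (W : WeierstrassCurve ℚ) [W.IsElliptic] [W.IsGloballyMinimal] (p : ℕ) [Fact p.Prime]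
      [NeZero (W.conductorNorm ℤ)],
      W.HasCM → W.analyticRank = 1 → 5 ≤ p → CMInert W p → ¬ Good W p →
      (∀ B : ℕ, ∃ (K : Type) (_ : Field K) (_ : NumberField K), IsImaginaryQuadratic K ∧
        B < (NumberField.discr K).natAbs ∧ 4 < (NumberField.discr K).natAbs ∧
        SatisfiesHeegnerHypothesis (W.conductorNorm ℤ) K ∧ ¬ p ∣ NumberField.classNumber K) →
      (∀ (K : Type) [Field K] [NumberField K], IsImaginaryQuadratic K → 4 < (NumberField.discr K).natAbs →
        SatisfiesHeegnerHypothesis (W.conductorNorm ℤ) K → NumberField.classNumber K < p →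
        (W.quadraticTwist (NumberField.discr K : ℚ)).entireLFunction 1 = 0) →
      ∃ (K : Type) (_ : Field K) (_ : NumberField K), IsImaginaryQuadratic K ∧
        4 < (NumberField.discr K).natAbs ∧ SatisfiesHeegnerHypothesis (W.conductorNorm ℤ) K ∧
        (W.quadraticTwist (NumberField.discr K : ℚ)).entireLFunction 1 ≠ 0 ∧
        ¬ p ∣ NumberField.classNumber K) ↔
    HeegnerTwistCouplingInSupply := by
  refine ⟨heegnerTwistCouplingInSupply_of_hTail, fun hcrux ↦ ?_⟩
  intro W _ _ p _ _ hCM hr hp5 hin hbad hsup _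
  exact hcrux W p hCM hr hp5 hin hbad hsup

end Summit.BirchSwinnertonDyer.BirchSwinnertonDyer.Theorems.BiquadraticEisensteinDescentHeegnerTwistCouplingInSupplyHTail

end
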